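import Summits.CriticalPhenomena.PercolationContinuityZ3.Theorems.Transplant.SkelFrmFromBParamsFaceLatA
import Summits.CriticalPhenomena.PercolationContinuityZ3.Theorems.Transplant.SkelFrmBParamsFaceLatA
import Summits.CriticalPhenomena.PercolationContinuityZ3.Theorems.Transplant.SkelNegBParamsFaceLatA
import Summits.CriticalPhenomena.PercolationContinuityZ3.Theorems.Transplant.SkelFrmFromBParamsFace
import Summits.CriticalPhenomena.PercolationContinuityZ3.Theorems.Transplant.SkelFrmBParamsFace
import Summits.CriticalPhenomena.PercolationContinuityZ3.Theorems.Transplant.SkelNegBParamsFace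
import Summits.CriticalPhenomena.PercolationContinuityZ3.Theorems.Transplant.SkelFrmFrom1SlotTypes
import Summits.CriticalPhenomena.PercolationContinuityZ3.Theorems.Transplant.SkelFrm1SlotTypes
import Summits.CriticalPhenomena.PercolationContinuityZ3.Theorems.Transplant.SkelFrmFrom1ParamsPO
import Summits.CriticalPhenomena.PercolationContinuityZ3.Theorems.Transplant.SkelFrm1ParamsPO
import Summits.CriticalPhenomena.PercolationContinuityZ3.Theorems.Transplant.SkelFrmFrom1ParamsLBL
import Summits.CriticalPhenomena.PercolationContinuityZ3.Theorems.Transplant.SkelFrm1ParamsLBL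
import Summits.CriticalPhenomena.PercolationContinuityZ3.Theorems.Transplant.SkelFrmFromBParamsKitA
import Summits.CriticalPhenomena.PercolationContinuityZ3.Theorems.Transplant.SkelFrmBParamsKitA
import Summits.CriticalPhenomena.PercolationContinuityZ3.Theorems.Transplant.SkelFrmFromBParamsKitS
import Summits.CriticalPhenomena.PercolationContinuityZ3.Theorems.Transplant.SkelFrmBParamsKitS
import Summits.CriticalPhenomena.PercolationContinuityZ3.Theorems.Transplant.SkelFrmFrom1ParamsLF
import Summits.CriticalPhenomena.PercolationContinuityZ3.Theorems.Transplant.SkelFrm1ParamsLF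
import Summits.CriticalPhenomena.PercolationContinuityZ3.Theorems.Transplant.SkelFrmFrom1ParamsLO
import Summits.CriticalPhenomena.PercolationContinuityZ3.Theorems.Transplant.SkelFrm1ParamsLO
import Summits.CriticalPhenomena.PercolationContinuityZ3.Theorems.Transplant.SkelFrmFromBParamsLF
import Summits.CriticalPhenomena.PercolationContinuityZ3.Theorems.Transplant.SkelFrmBParamsLF
import Summits.CriticalPhenomena.PercolationContinuityZ3.Theorems.Transplant.SkelFrmFromBParamsFineSize
import Summits.CriticalPhenomena.PercolationContinuityZ3.Theorems.Transplant.SkelFrmBParamsFineSize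
import Summits.CriticalPhenomena.PercolationContinuityZ3.Theorems.Transplant.SkelFrmFromBParamsLFA
import Summits.CriticalPhenomena.PercolationContinuityZ3.Theorems.Transplant.SkelFrmBParamsLFA
import Summits.CriticalPhenomena.PercolationContinuityZ3.Theorems.Transplant.SkelFrmFromBParamsLO
import Summits.CriticalPhenomena.PercolationContinuityZ3.Theorems.Transplant.SkelFrmBParamsLO
import Summits.CriticalPhenomena.PercolationContinuityZ3.Theorems.Transplant.SkelFrmFromBParamsB
import Summits.CriticalPhenomena.PercolationContinuityZ3.Theorems.Transplant.SkelFrmBParamsB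
import Summits.CriticalPhenomena.PercolationContinuityZ3.Theorems.Transplant.SkelFrmFromBParamsFineSizeA
import Summits.CriticalPhenomena.PercolationContinuityZ3.Theorems.Transplant.SkelFrmBParamsFineSizeA
import Summits.CriticalPhenomena.PercolationContinuityZ3.Theorems.Transplant.SkelFrmFromBParamsSlotsR
import Summits.CriticalPhenomena.PercolationContinuityZ3.Theorems.Transplant.SkelFrmBParamsSlotsR
import Summits.CriticalPhenomena.PercolationContinuityZ3.Theorems.Transplant.SkelFrmFromBParamsSlotsRS
import Summits.CriticalPhenomena.PercolationContinuityZ3.Theorems.Transplant.SkelFrmBParamsSlotsRS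
import Summits.CriticalPhenomena.PercolationContinuityZ3.Theorems.Transplant.SkelFrmFromBParamsSlots
import Summits.CriticalPhenomena.PercolationContinuityZ3.Theorems.Transplant.SkelFrmBParamsSlots
import Summits.CriticalPhenomena.PercolationContinuityZ3.Theorems.Transplant.SkelFrmFromBParamsSched
import Summits.CriticalPhenomena.PercolationContinuityZ3.Theorems.Transplant.SkelFrmBParamsSched
import Summits.CriticalPhenomena.PercolationContinuityZ3.Theorems.Transplant.SkelFrmFromBParamsSlotsT
import Summits.CriticalPhenomena.PercolationContinuityZ3.Theorems.Transplant.SkelFrmBParamsSlotsT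
import Summits.CriticalPhenomena.PercolationContinuityZ3.Theorems.Transplant.SkelFrmFromBParamsReachFC
import Summits.CriticalPhenomena.PercolationContinuityZ3.Theorems.Transplant.SkelFrmBParamsReachFC
import Summits.CriticalPhenomena.PercolationContinuityZ3.Theorems.Transplant.SkelFrmFromBParamsSlotsTA
import Summits.CriticalPhenomena.PercolationContinuityZ3.Theorems.Transplant.SkelFrmBParamsSlotsTA
import Summits.CriticalPhenomena.PercolationContinuityZ3.Theorems.Transplant.SkelFrmFromBParamsFaceLat
import Summits.CriticalPhenomena.PercolationContinuityZ3.Theorems.Transplant.SkelFrmBParamsFaceLat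
import Summits.CriticalPhenomena.PercolationContinuityZ3.Theorems.Transplant.SkelNegBParamsFaceA
import Summits.CriticalPhenomena.PercolationContinuityZ3.Theorems.Transplant.PlanarSkeletonFrmFromDefs
import Summits.CriticalPhenomena.PercolationContinuityZ3.Theorems.Transplant.PlanarSkeletonFrmDefs
import Summits.CriticalPhenomena.PercolationContinuityZ3.Theorems.Transplant.SkelPhiStepIDataNS
import HarnessLib
import Summits.CriticalPhenomena.PercolationContinuityZ3.Theorems.Transplant.SkelFrmBParamsFaceA
/-!
# U-WAVE PORT (RULING D-U, lead g21 2026-08-26; WAVE-U-MANIFEST v3.1 row «SkelFrmBParamsFaceA» ↦ «SkelFrmFromBParamsFaceA») of the tree module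
# `Transplant/SkelFrmBParamsFaceA` onto the carrier `PlanarSkeletonFrmFrom` (frames only, cylinders connected from width `ℓ₀` on)

ORIGINAL TITLE: N2 (frames-only node `SamePDropOfSkeletonFrmFrom₁`, OPEN) params column over `PlanarSkeletonFrm` — (ζ″) ledger, shape (B′) of record ((R-14)):

builds on p205010 (kernel theorem, internal audit signed; external expert review pending) — nothing in this file uses p205010; NOTHING is claimed about the
OPEN node U `SamePDropOfSkeletonFrmFrom₁` (nor U_s / the end state).  Lane `prim-bschramm`, seat `prim-bschramm-stmt` gen 26 (port pen, RULING M-11 family P-stmt; tool = p3-g26's port_u.py of record, registry-driven inputs); helper file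
(`--supports stmt-CriticalPhenomena-4575 --as helper`).  PORT RULES r1–r4 of RULING D-U: declaration order and proof texts are those of the original,
byte-identical except (i) the carrier token `PlanarSkeletonFrm ↦ PlanarSkeletonFrmFrom` (binders, `namespace`/`end` lines, qualified names of twinned
declarations), (ii) carrier-FREE declarations of the original (φ-level `Skelφ…` blocks and namespace-only arithmetic residents) are NOT re-declared —
this file imports the original and `export`s the twin-free residents (POLICY T / treatment (m1)); residents whose statement mentions a twinned
constant are copied, (iii) every carrier-binding declaration keeps its explicit binder `(Φ : PlanarSkeletonFrmFrom G)` in its own signature (r2).  Docstrings and citations are the original's.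
-/

noncomputable section

open scoped Classical

namespace Summit.CriticalPhenomena.PercolationContinuityZ3.Theorems.Transplant

namespace PlanarSkeletonFrmFrom

namespace NegB

open Literature.Probability.Percolation Literature.Probability.LatticeModels SimpleGraph
open Literature.Probability.Percolation.KozmaNitzan.Cells (oth)
open SkelConc (Consts)
open Skelφ.StepI (DataN)
open TwoAxis.Para (modulus)
open Neg

/-! ## §1 Lattice facts at `prFA`: `D_A ≤ L₀·L₁`, `Mabs ≤ 2·rdK_I·D_A`, `awNum` unfolded -/

section Lattice

/-- **`D_A ≤ L₀·L₁`** (`D_A = A²·m`, `L₀ = A(|v_L|+|v_β|)`, `L₁ = A(|n|+|h|)`). [folklore] -/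
theorem D_le_L_mulA (κ : Consts) {V : Type} [DecidableEq V] [Countable V] {G : SimpleGraph V} [G.LocallyFinite] (Φ : PlanarSkeletonFrmFrom G) (t : V) (p : unitInterval) (D : Skelφ.StepI.DataNS V) (g : ℕ) (f : ℕ) : (prFA κ Φ t p D g f).D ≤ (prFA κ Φ t p D g f).L 0 * (prFA κ Φ t p D g f).L 1 := by
  obtain ⟨hA, hn, hh, hvα, hvβ, -, -, hD⟩ := prFA_fields κ Φ t p D g f
  have hm := modulus_le_Lhat_mul κ Φ t p D g f
  have hA0 : 0 ≤ Aof κ := (Aof_pos κ).1.le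
  rw [Skelφ.FinePrm.L_zero, Skelφ.FinePrm.L_one, hA, hn, hh, hvα, hvβ, hD, Skelφ.NegPrm.DofA_eq, abs_of_nonneg hA0]
  change Aof κ ^ 2 * modulus (nL κ Φ t p D g f) (hL κ Φ t p D g f) (vL κ Φ t p D g f) (vβL κ Φ t p D g f) ≤ _
  have hm0 : 0 ≤ (|vL κ Φ t p D g f| + |vβL κ Φ t p D g f|) * (|(nL κ Φ t p D g f : ℤ)| + |hL κ Φ t p D g f|) := by positivity
  have hA2 : 0 ≤ Aof κ ^ 2 := pow_nonneg hA0 2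
  calc Aof κ ^ 2 * modulus (nL κ Φ t p D g f) (hL κ Φ t p D g f) (vL κ Φ t p D g f) (vβL κ Φ t p D g f)
      ≤ Aof κ ^ 2 * ((|vL κ Φ t p D g f| + |vβL κ Φ t p D g f|) * (|(nL κ Φ t p D g f : ℤ)| + |hL κ Φ t p D g f|)) :=
        mul_le_mul_of_nonneg_left hm hA2
    _ = Aof κ * (|vL κ Φ t p D g f| + |vβL κ Φ t p D g f|) * (Aof κ * (|(nL κ Φ t p D g f : ℤ)| + |hL κ Φ t p D g f|)) := by ring

/-- **`Mabs ≤ 2·rdK I (bOf I)·D_A`** for both level axes (the `A` cancels). [folklore] -/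
theorem Mabs_le_two_rdK_DA (κ : Consts) {V : Type} [DecidableEq V] [Countable V] {G : SimpleGraph V} [G.LocallyFinite] (Φ : PlanarSkeletonFrmFrom G) (t : V) (p : unitInterval) (D : Skelφ.StepI.DataNS V) (g : ℕ) (f : ℕ) (hN : EqNumL κ Φ t p D g f) (I : Fin 2) :
    (prFA κ Φ t p D g f).Mabs ≤ 2 * (prFA κ Φ t p D g f).rdK I ((prFA κ Φ t p D g f).bOf I) * (prFA κ Φ t p D g f).D := by
  set pr := prFA κ Φ t p D g f
  have hM := Mabs_eqA κ Φ t p D g f hN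
  have hDL := D_le_L_mulA κ Φ t p D g f
  have hx := rdK_lowerA κ Φ t p D g f I
  have hJ := cL_upperA κ Φ t p D g f hN (oth I)
  have hAp : 0 < Aof κ := (Aof_pos κ).1
  have hDpos : 0 < pr.D := by
    obtain ⟨hn1, hℓ1⟩ := one_le_of_eqNumL κ Φ t p D g f hN
    have e : pr.D = Skelφ.NegPrm.DofA (Aof κ) (nL κ Φ t p D g f) (hL κ Φ t p D g f) (ℓL κ Φ t p D g f) (vL κ Φ t p D g f) :=
      (prFA_fields κ Φ t p D g f).2.2.2.2.2.2.2
    rw [e]; exact Skelφ.NegPrm.DofA_pos (Aof_pos κ).2 hn1 hℓ1 _ _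
  obtain ⟨hc₀, hc₁⟩ := prFA_c_pos κ Φ t p D g f
  have hcI : 0 < pr.cOf I := pr.cOf_pos hc₀ hc₁ I
  have hLJ : 0 < pr.L (oth I) := by
    have hnz := pr.lvGen_bOf_ne_zero (oth I) (pr.lvGen_ne_zero_of_detD_pos (prFA_D κ Φ t p D g f) hDpos (oth I))
    have hA : pr.A = Aof κ := (prFA_fields κ Φ t p D g f).1
    have hb : |pr.lvGen (oth I) (pr.bOf (oth I))| ≤ |pr.lvGen (oth I) 0| + |pr.lvGen (oth I) 1| := by
      obtain h | h : pr.bOf (oth I) = 0 ∨ pr.bOf (oth I) = 1 := by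
        generalize pr.bOf (oth I) = b; exact (by fin_cases b <;> simp)
      · rw [h]; linarith [abs_nonneg (pr.lvGen (oth I) 1)]
      · rw [h]; linarith [abs_nonneg (pr.lvGen (oth I) 0)]
    unfold Skelφ.FinePrm.L; rw [hA, abs_of_pos hAp]
    have : 0 < |pr.lvGen (oth I) (pr.bOf (oth I))| := abs_pos.2 hnz
    have hs : 0 < |pr.lvGen (oth I) 0| + |pr.lvGen (oth I) 1| := by linarith
    exact mul_pos hAp hs
  -- `c₀·c₁ = c_I·c_J` and `L 0 · L 1 = L_I · L_J`
  have hcc : pr.c₀ * pr.c₁ = pr.cOf I * pr.cOf (oth I) := by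
    obtain rfl | rfl : I = 0 ∨ I = 1 := by fin_cases I <;> simp
    · rw [Skelφ.FinePrm.cOf_zero, show oth (0 : Fin 2) = 1 from rfl, Skelφ.FinePrm.cOf_one]
    · rw [Skelφ.FinePrm.cOf_one, show oth (1 : Fin 2) = 0 from rfl, Skelφ.FinePrm.cOf_zero, mul_comm]
  have hLL : pr.L 0 * pr.L 1 = pr.L I * pr.L (oth I) := by
    obtain rfl | rfl : I = 0 ∨ I = 1 := by fin_cases I <;> simp
    · rw [show oth (0 : Fin 2) = 1 from rfl]
    · rw [show oth (1 : Fin 2) = 0 from rfl, mul_comm]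
  rw [hcc] at hM; rw [hLL] at hDL
  -- `A·M·L_J = c_I·(c_J L_J)·D ≤ c_I·D·D ≤ c_I·D·L_I·L_J ≤ 2A·x·D·L_J`
  have h1 : Aof κ * pr.Mabs * pr.L (oth I) ≤ pr.cOf I * pr.D * pr.D := by
    have : Aof κ * pr.Mabs * pr.L (oth I) = pr.cOf I * (pr.cOf (oth I) * pr.L (oth I)) * pr.D := by rw [hM]; ring
    rw [this]
    have hcD : 0 ≤ pr.cOf I * pr.D := (mul_pos hcI hDpos).le
    nlinarith
  have h2 : pr.cOf I * pr.D * pr.D ≤ 2 * Aof κ * pr.rdK I (pr.bOf I) * pr.D * pr.L (oth I) := by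
    have hcD : 0 ≤ pr.cOf I * pr.D := (mul_pos hcI hDpos).le
    have hDL' : 0 ≤ pr.D * pr.L (oth I) := (mul_pos hDpos hLJ).le
    calc pr.cOf I * pr.D * pr.D ≤ pr.cOf I * pr.D * (pr.L I * pr.L (oth I)) := mul_le_mul_of_nonneg_left hDL hcD
      _ = (pr.cOf I * pr.L I) * (pr.D * pr.L (oth I)) := by ring
      _ ≤ (2 * Aof κ * pr.rdK I (pr.bOf I)) * (pr.D * pr.L (oth I)) := mul_le_mul_of_nonneg_right hx hDL'
      _ = 2 * Aof κ * pr.rdK I (pr.bOf I) * pr.D * pr.L (oth I) := by ring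
  have h3 : (Aof κ * pr.Mabs) * pr.L (oth I) ≤ (Aof κ * (2 * pr.rdK I (pr.bOf I) * pr.D)) * pr.L (oth I) := by linarith
  have h4 := le_of_mul_le_mul_right h3 hLJ
  exact le_of_mul_le_mul_left (by linarith) hAp

/-- **`awNum` unfolded at `prFA`**: `awNum (I, ·) = (rdK I b·(2r_J + 1) + rdN I b)·D_A`, `b := bOf I`, `J := oth I`. [folklore] -/
theorem awNum_eqA (κ : Consts) {V : Type} [DecidableEq V] [Countable V] {G : SimpleGraph V} [G.LocallyFinite] (Φ : PlanarSkeletonFrmFrom G) (t : V) (p : unitInterval) (D : Skelφ.StepI.DataNS V) (g : ℕ) (f : ℕ) (P : PCells2) (I : Fin 2) :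
    (prFA κ Φ t p D g f).awNum P (I, true) =
      ((prFA κ Φ t p D g f).rdK I ((prFA κ Φ t p D g f).bOf I) * (2 * (P.r (oth I) : ℤ) + 1) + (prFA κ Φ t p D g f).rdN I ((prFA κ Φ t p D g f).bOf I)) *
        (prFA κ Φ t p D g f).D := by
  set pr := prFA κ Φ t p D g f
  obtain rfl | rfl : I = 0 ∨ I = 1 := by fin_cases I <;> simp
  · have e0 : P.faceExt ((0 : Fin 2), true) 0 = 0 := by simp [PCells2.faceExt]
    have e1 : P.faceExt ((0 : Fin 2), true) 1 = 2 * (P.r 1 : ℤ) := by simp [PCells2.faceExt, show oth (0 : Fin 2) = 1 from rfl]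
    show (pr.rdK 1 (pr.bOf 0) * (P.faceExt (0, true) 0 + 1) + pr.rdK 0 (pr.bOf 0) * (P.faceExt (0, true) 1 + 1)) * pr.D = _
    rw [e0, e1, Skelφ.FinePrm.rdN_zero, Skelφ.FinePrm.rdK_one, show oth (0 : Fin 2) = 1 from rfl]; ring
  · have e0 : P.faceExt ((1 : Fin 2), true) 0 = 2 * (P.r 0 : ℤ) := by simp [PCells2.faceExt, show oth (1 : Fin 2) = 0 from rfl]
    have e1 : P.faceExt ((1 : Fin 2), true) 1 = 0 := by simp [PCells2.faceExt]
    show (pr.rdK 1 (pr.bOf 1) * (P.faceExt (1, true) 0 + 1) + pr.rdK 0 (pr.bOf 1) * (P.faceExt (1, true) 1 + 1)) * pr.D = _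
    rw [e0, e1, Skelφ.FinePrm.rdN_one, Skelφ.FinePrm.rdK_zero, show oth (1 : Fin 2) = 0 from rfl]; ring

end Lattice

/-! ## §2 The (F) floor `hkF` at `g := gT` -/

section AtT

/-- **`hkF` at the (ζ′) record**: `kFF₂ (prFA) fcellsA Rl I + 3 ≤ 5·r_(oth I)` for every `Rl ≤ RA′`, both axes, at `g := gT mk gx`. [cite: KozmaNitzan2024, §4 Lemma 10 Step IV] -/
theorem hkF_RA (κ : Consts) {V : Type} [DecidableEq V] [Countable V] {G : SimpleGraph V} [G.LocallyFinite] (Φ : PlanarSkeletonFrmFrom G) (t : V) (p : unitInterval) (D : Skelφ.StepI.DataNS V) (f : ℕ) (mk : ℕ) (gx : Neg.FSlot) (hN : EqNumL κ Φ t p D (KS.gT mk gx κ Φ t p D) f) (hκ : (hL κ Φ t p D (KS.gT mk gx κ Φ t p D) f).natAbs ≤ 10 * nL κ Φ t p D (KS.gT mk gx κ Φ t p D) f)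
    {Rl : ℕ} (hRl : Rl ≤ KS.RA' κ Φ t p D mk) (I : Fin 2) :
    (prFA κ Φ t p D (KS.gT mk gx κ Φ t p D) f).kFF₂ (fcellsA κ Φ t p D (KS.gT mk gx κ Φ t p D) f) Rl I + 3 ≤
      5 * ((fcellsA κ Φ t p D (KS.gT mk gx κ Φ t p D) f).r (oth I) : ℤ) := by
  set pr := prFA κ Φ t p D (KS.gT mk gx κ Φ t p D) f
  set P := fcellsA κ Φ t p D (KS.gT mk gx κ Φ t p D) f
  have hDpos : 0 < pr.D := by
    obtain ⟨hn1, hℓ1⟩ := one_le_of_eqNumL κ Φ t p D (KS.gT mk gx κ Φ t p D) f hN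
    have e : pr.D = Skelφ.NegPrm.DofA (Aof κ) (nL κ Φ t p D (KS.gT mk gx κ Φ t p D) f) (hL κ Φ t p D (KS.gT mk gx κ Φ t p D) f)
        (ℓL κ Φ t p D (KS.gT mk gx κ Φ t p D) f) (vL κ Φ t p D (KS.gT mk gx κ Φ t p D) f) :=
      (prFA_fields κ Φ t p D (KS.gT mk gx κ Φ t p D) f).2.2.2.2.2.2.2
    rw [e]; exact Skelφ.NegPrm.DofA_pos (Aof_pos κ).2 hn1 hℓ1 _ _
  obtain ⟨hc₀, hc₁⟩ := prFA_c_pos κ Φ t p D (KS.gT mk gx κ Φ t p D) f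
  have hDd := prFA_D κ Φ t p D (KS.gT mk gx κ Φ t p D) f
  have hx : 0 < pr.rdK I (pr.bOf I) := rdK_pos_RA κ Φ t p D _ f hN I
  have hM : 0 < pr.Mabs := pr.Mabs_pos hc₀ hc₁ hDd hDpos
  have hy0 : 0 ≤ pr.rdN I (pr.bOf I) := by
    unfold Skelφ.FinePrm.rdN; exact mul_nonneg (pr.cOf_pos hc₀ hc₁ (oth I)).le (abs_nonneg _)
  have hy : pr.rdN I (pr.bOf I) ≤ pr.rdK I (pr.bOf I) * 3 := rdN_le_three_rdKA κ Φ t p D _ f hN I (eleven_le_s_TA κ Φ t p D f mk gx hN hκ I)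
  have hM2 : pr.Mabs ≤ 2 * pr.rdK I (pr.bOf I) * pr.D := Mabs_le_two_rdK_DA κ Φ t p D _ f hN I
  -- `r_J ≥ K·Kq·(6RA'+11) ≥ 40(6Rl+11)`
  have hr : 40 * (6 * (Rl : ℤ) + 11) ≤ (P.r (oth I) : ℤ) := by
    obtain ⟨h0, h1⟩ := KS.r_geTA κ Φ t p D mk gx f hN hκ
    have hK : (40 : ℤ) ≤ Neg.K κ := by exact_mod_cast (Neg.forty_le_K κ).1
    have hKq : (1 : ℤ) ≤ Neg.Kq κ := by exact_mod_cast Neg.one_le_Kq κ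
    have hRl' : (Rl : ℤ) ≤ KS.RA' κ Φ t p D mk := by exact_mod_cast hRl
    have hR0 : (0 : ℤ) ≤ Rl := Nat.cast_nonneg _
    have hq6 : 6 * (Rl : ℤ) + 11 ≤ (Neg.Kq κ : ℤ) * (6 * (KS.RA' κ Φ t p D mk : ℤ) + 11) := by nlinarith
    have hq40 : 40 * (6 * (Rl : ℤ) + 11) ≤ (Neg.K κ : ℤ) * ((Neg.Kq κ : ℤ) * (6 * (KS.RA' κ Φ t p D mk : ℤ) + 11)) := by nlinarith
    have hq14 : 40 * (6 * (Rl : ℤ) + 11) ≤ (Neg.K κ : ℤ) * ((Neg.Kq κ : ℤ) * (14 * (KS.RA' κ Φ t p D mk : ℤ) + 27)) := by nlinarith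
    obtain rfl | rfl : I = 0 ∨ I = 1 := by fin_cases I <;> simp
    · rw [show oth (0 : Fin 2) = 1 from rfl]; linarith
    · rw [show oth (1 : Fin 2) = 0 from rfl]; linarith
  -- the ceilings
  set aw := pr.awF₂ P (I, true) with haw
  have haw' : pr.Mabs * aw ≤ pr.awNum P (I, true) + pr.Mabs - 1 := by
    rw [haw]; unfold Skelφ.FinePrm.awF₂; exact Int.mul_ediv_self_le hM.ne'
  rw [awNum_eqA] at haw'
  set x := pr.rdK I (pr.bOf I)
  set y := pr.rdN I (pr.bOf I)
  set r := (P.r (oth I) : ℤ)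
  have hxD : 0 < x * pr.D := mul_pos hx hDpos
  set q := pr.kFF₂ P Rl I with hq
  have hq' : x * pr.D * q ≤ pr.Mabs * (aw + Rl + 1) + y * (Rl + 2) * pr.D + x * pr.D - 1 := by
    rw [hq]; unfold Skelφ.FinePrm.kFF₂; exact Int.mul_ediv_self_le hxD.ne'
  -- combine
  have hR0 : (0 : ℤ) ≤ Rl := Nat.cast_nonneg _
  have hyR : y * ((Rl : ℤ) + 2) * pr.D ≤ x * 3 * ((Rl : ℤ) + 2) * pr.D := by
    have : 0 ≤ ((Rl : ℤ) + 2) * pr.D := mul_nonneg (by linarith) hDpos.le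
    nlinarith
  have hMR : pr.Mabs * ((Rl : ℤ) + 2) ≤ 2 * x * pr.D * ((Rl : ℤ) + 2) := mul_le_mul_of_nonneg_right hM2 (by linarith)
  have key : x * pr.D * (q + 3) < x * pr.D * (5 * r) := by nlinarith
  have := lt_of_mul_lt_mul_left key hxD.le
  linarith

end AtT

end NegB

end PlanarSkeletonFrmFrom

end Summit.CriticalPhenomena.PercolationContinuityZ3.Theorems.Transplant
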